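/-
Copyright (c) 2026 the pub-hodgecm-mathlib formalisation cell (harness21).  Prover seat hodgecm-mathlib-LH7-p04 (g3), 2026-09-02 (LH7 leaf ED. 3 road,
O8b census residual (iii): the measure-theoretic half of «`G(𝔸_f)`-eigenfunctions are constant multiples of the character» — Moore's ergodicity
lemma for a normal subgroup with dense orbit on a homogeneous space).
-/
import Mathlib.Dynamics.Ergodic.Action.Regular
import Mathlib.MeasureTheory.Function.LpSpace.DomAct.Continuous
import Literature.NumberTheory.Automorphic.AutomorphicQuotientErgodic
import HarnessLib

/-!
# Ergodicity of a normal subgroup with dense orbit on a homogeneous space (Moore's lemma); subgroups of `G(𝔸_K)` acting ergodically on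
# the automorphic quotient

Topic `NumberTheory/Automorphic`; THEOREMS ONLY (no definition, no instance, no named fact, no notation, no `sorry`).  Sequel of ★
`AutomorphicQuotientErgodic` (ergodicity of the FULL group `G(𝔸_K)` on `X = G(𝔸_K) ⧸ (A_G · G(K))`); companion ★-sequel `AutomorphicCharacterLineSubgroup`
(eigenfunctions of a subgroup).

THE MATHEMATICS ([Zimmer1984] §2.2, «Moore's ergodicity duality» Cor. 2.2.3 with Lemma 2.2.13; [BekkaMayer2000] Ch. III §1).  Let `G` be a locally
compact second countable group acting continuously and transitively on a Borel space `X` with an invariant s-finite measure `μ`, `x₀ ∈ X` with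
stabilizer `H`, and `M ⊴ G` a CLOSED NORMAL subgroup such that `M · H` is DENSE in `G`.  Then `M` acts ERGODICALLY on `(X, μ)`: a measurable `s ⊆ X`
with `m⁻¹ s = s` a.e. for every `m ∈ M` is null or conull.  Proof: for a left Haar measure `ν` on `G` and `Θ(g) = g • x₀`, Tonelli (★
`lintegral_measure_preimage_smul`) gives `μ A = 0 ↔ ν (Θ⁻¹ A) = 0` (`measure_eq_zero_iff_measure_preimage_orbit_eq_zero`).  The set `S = Θ⁻¹ s ⊆ G`
is EXACTLY right-`H`-invariant and a.e. left-`M`-invariant; replacing it by `S' = {g | mg ∈ S for ν_M-a.e. m ∈ M}` (Haar measure `ν_M` of the closed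
subgroup `M`; `S' = S` a.e. by Fubini) makes the left-`M`-invariance EXACT while keeping the right-`H`-invariance, and normality of `M` turns exact
left-`M`-invariance into exact right-`M`-invariance (`g m = (g m g⁻¹) g`).  So `T = S'⁻¹` is exactly left-invariant under the dense set `M · H`.
For a measurable `C` of finite measure the function `g ↦ ν (g T ∩ C) = ∫_T 𝟙_C (g x) dν(x)` is continuous (continuity of translation in `L¹(G, ν)`,
Mathlib `Lp.instContinuousSMulDomMulAct`) and constant on `M · H`, hence constant; exhausting `G` by sets of finite measure, `g T = T` a.e. for EVERY
`g ∈ G`, so `T` is `ν`-null or conull by the ergodicity of `G` on itself (Mathlib `ErgodicSMul G G ν`), and so are `S'`, `S` and finally `s`.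

* §1 (abstract, Mathlib generality) `measure_eq_zero_iff_measure_preimage_orbit_eq_zero` — the null-set dictionary `μ A = 0 ↔ ν (Θ⁻¹ A) = 0`
  (the dictionary inside the proof of ★ `ergodicSMul_of_isPretransitive`, exported); `smul_set_ae_eq_of_dense` — a measurable subset of `G`
  EXACTLY invariant under a dense set of left translations is a.e. invariant under every left translation;
  **`ergodicSMul_subgroup_of_dense_mul_stabilizer`** — Moore's lemma as above (`ErgodicSMul M X μ`); the function form «an a.e. strongly
  measurable `f` with `f (m • x) = f x` a.e. for every `m ∈ M` is a.e. constant» is then ★ `ae_eq_const_of_forall_smul_ae_eq` with `G := M`.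
* §2 `AdelicGroupData.ergodicSMul_subgroup_automorphicQuotient` — for an adelic group datum `𝒢` with `G(𝔸_K)` locally compact second countable, an
  automorphic measure `μ`, and a closed normal subgroup `M ≤ G(𝔸_K)` with `M · (A_G · G(K))` dense in `G(𝔸_K)`, **`M` acts ergodically on the
  automorphic quotient**; `AdelicGroupData.ae_eq_const_of_forall_mem_rightRegular_apply_eq` — **an `L²` function on the automorphic quotient fixed
  by `R(m)` for every `m ∈ M` is a.e. constant**.

CONSUMER (cell `hodgecm-mathlib`, crux H413 = stmt-HodgeConjecture-24833, line LH7, leaf ED. 3 print organs O8b `PKmultOneU2Shape` ∕ O8a `PKsaU2Shape`):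
with `M` = the image of `U(Φ₂)(𝔸_{L⁺,f})` in `U(Φ₂)(𝔸_{L⁺})` the density hypothesis is WEAK APPROXIMATION at the archimedean places for `U(Φ₂)`
(`U(Φ₂)(L⁺)` dense in `U(Φ₂)(L⁺ ⊗ ℝ)`, [PlatonovRapinchuk1994] §7.3 Prop. 7.8); the companion `AutomorphicCharacterLineSubgroup` turns the
ergodicity into «an `L²` automorphic function on which `U(Φ₂)(𝔸_{L⁺,f})` acts by an automorphic character is a constant multiple of it» (residual
(iii) of the O8b census `F0/P3a/F0P3a-p03/g20/CENSUS-O8b-PKmultOneU2.F0P3ap03g20.md`).  Nothing here is specific to unitary groups.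
HONEST LABEL: generic measure theory; HC_CM is proved only modulo the printed citations of that programme until its rung 0 closes; this file proves no
printed citation of it.

## References
* [Zimmer1984] R. J. Zimmer, *Ergodic theory and semisimple groups*, Monographs in Math. 81 (1984), §2.2 (Moore's ergodicity theorem; Lemma 2.2.13,
  Cor. 2.2.3: `H` is ergodic on `G/M` iff `M` is ergodic on `G/H`), App. B (a.e. invariant versus strictly invariant, Prop. B.5).
* [BekkaMayer2000] M. B. Bekka, M. Mayer, *Ergodic theory and topological dynamics of group actions on homogeneous spaces* (2000), Ch. III §1.
* [PlatonovRapinchuk1994] V. Platonov, A. Rapinchuk, *Algebraic Groups and Number Theory* (1994), §7.3 Prop. 7.8 (weak approximation at `∞`).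

Mathlib: `Measure.haar`, `ErgodicSMul G G ν`, `Lp.instContinuousSMulDomMulAct`, `DomMulAct.smul_Lp_ae_eq`, `continuous_setIntegral`,
`Measure.ae_ae_comm`, `measure_mul_right_null`, `measure_inv_null`, `measurable_measure_prodMk_right`, `MulAction.stabilizer_quotient`.
-/

set_option autoImplicit false

noncomputable section

open MeasureTheory Filter Set Topology
open scoped ENNReal Pointwise

namespace Literature.NumberTheory.Automorphic

/-! ## §1 Moore's lemma: a closed normal subgroup `M` with `M · Stab(x₀)` dense acts ergodically on a homogeneous space -/

section Subgroup

variable {G X : Type*} [Group G] [TopologicalSpace G] [IsTopologicalGroup G]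
  [SecondCountableTopology G] [LocallyCompactSpace G] [MulAction G X] [TopologicalSpace X] [MeasurableSpace X]
  [BorelSpace X] [ContinuousSMul G X] [MulAction.IsPretransitive G X]

omit [LocallyCompactSpace G] in
/-- **The null-set dictionary of a homogeneous space.**  For a transitive continuous action of a locally compact second countable group `G` on a
Borel space `X`, a `G`-invariant s-finite measure `μ` on `X`, a left-invariant s-finite measure `ν` on `G` positive on non-empty open sets (a left
Haar measure) and a base point `x₀`: a measurable `A ⊆ X` is `μ`-null iff its preimage under the orbit map `Θ(g) = g • x₀` is `ν`-null.  Both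
directions come from Tonelli `∫⁻ x, ν {g | g • x ∈ A} ∂μ = μ A · ν G` (★ `lintegral_measure_preimage_smul`), every orbit map being a right translate
of `Θ` and `ν` being right quasi-invariant (Mathlib `measure_mul_right_null`); this is the dictionary inside the proof of ★
`ergodicSMul_of_isPretransitive`, exported. [cite: Zimmer1984, §2.2 Lemma 2.2.13] -/
theorem measure_eq_zero_iff_measure_preimage_orbit_eq_zero [MeasurableSpace G] [BorelSpace G]
    (μ : Measure X) [SFinite μ] [NeZero μ] [SMulInvariantMeasure G X μ] (ν : Measure G) [SFinite ν]
    [ν.IsMulLeftInvariant] [ν.IsOpenPosMeasure] (x₀ : X) {A : Set X} (hA : MeasurableSet A) :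
    μ A = 0 ↔ ν ((fun g : G => g • x₀) ⁻¹' A) = 0 := by
  set Θ : G → X := fun g => g • x₀ with hΘ
  constructor
  · intro hA0
    have h := lintegral_measure_preimage_smul μ ν hA
    rw [hA0, zero_mul] at h
    have hmE : MeasurableSet ((fun p : X × G => p.2 • p.1) ⁻¹' A) :=
      measurableSet_preimage (measurable_snd.smul measurable_fst) hA
    have hae : ∀ᵐ x ∂μ, ν ((· • x) ⁻¹' A) = 0 :=
      (lintegral_eq_zero_iff (measurable_measure_prodMk_left hmE)).1 h
    obtain ⟨x₁, hx₁⟩ := hae.exists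
    obtain ⟨k, hk⟩ := MulAction.exists_smul_eq G x₁ x₀
    have hpre : Θ ⁻¹' A = (· * k) ⁻¹' ((· • x₁) ⁻¹' A) := by
      ext g
      simp only [mem_preimage, hΘ, ← hk, mul_smul]
    rw [hpre, measure_mul_right_null]
    exact hx₁
  · intro hA0
    have hall : ∀ x : X, ν ((· • x) ⁻¹' A) = 0 := by
      intro x
      obtain ⟨k, hk⟩ := MulAction.exists_smul_eq G x₀ x
      have hk' : (fun g : G => g • x) ⁻¹' A = (· * k) ⁻¹' (Θ ⁻¹' A) := by
        ext g
        simp only [mem_preimage, hΘ, ← hk, mul_smul]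
      rw [hk', measure_mul_right_null]
      exact hA0
    have h := lintegral_measure_preimage_smul μ ν hA
    simp_rw [hall, lintegral_zero] at h
    have hν : ν univ ≠ 0 := isOpen_univ.measure_ne_zero ν ⟨1, trivial⟩
    exact (mul_eq_zero.1 h.symm).resolve_right hν

/-- **Exact invariance under a dense set of left translations forces a.e. invariance under every left translation.**  For a left Haar measure `ν`
on a locally compact second countable group `G`, a measurable `T ⊆ G` and a dense `D ⊆ G` with `d • T = T` for every `d ∈ D`: `g • T = T` a.e. for
every `g ∈ G`.  For a measurable `C` of finite measure the function `g ↦ ν (g • T ∩ C) = ∫_{T} 𝟙_C (g x) dν(x)` is continuous (continuity of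
translation in `L¹(G, ν)`, Mathlib `Lp.instContinuousSMulDomMulAct`, composed with the continuous functional `F ↦ ∫_T F`), and it is constant on
`D`, hence constant; with `C` running through `K_n ∩ T` and `K_n \ T` for a compact exhaustion `(K_n)` this gives `ν (g • T ∆ T) = 0`.
[cite: Zimmer1984, App. B Prop. B.5] -/
theorem smul_set_ae_eq_of_dense [MeasurableSpace G] [BorelSpace G] (ν : Measure G) [ν.IsHaarMeasure]
    [ν.InnerRegularCompactLTTop] {T : Set G} (hT : MeasurableSet T) {D : Set G} (hD : Dense D)
    (hinv : ∀ d ∈ D, d • T = T) (g : G) : g • T =ᵐ[ν] T := by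
  haveI : Fact ((1 : ℝ≥0∞) ≤ 1) := ⟨le_rfl⟩
  haveI : Fact ((1 : ℝ≥0∞) ≠ ∞) := ⟨ENNReal.one_ne_top⟩
  -- (1) for every measurable `C` of finite measure, `ν (g • T ∩ C) = ν (T ∩ C)` for all `g`
  have key : ∀ C : Set G, MeasurableSet C → ν C ≠ ∞ → ∀ g : G, ν (g • T ∩ C) = ν (T ∩ C) := by
    intro C hC hCfin
    set F : Lp ℝ 1 ν := indicatorConstLp 1 hC hCfin (1 : ℝ) with hF
    set Ψ : G → ℝ := fun g => ∫ x in T, ((DomMulAct.mk g • F : Lp ℝ 1 ν) : G → ℝ) x ∂ν with hΨ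
    have hΨc : Continuous Ψ :=
      (continuous_setIntegral T).comp ((DomMulAct.continuous_mk.comp continuous_id).smul continuous_const)
    -- the value of `Ψ`
    have hΨv : ∀ g : G, Ψ g = ν.real (g • T ∩ C) := by
      intro g
      have h1 : ((DomMulAct.mk g • F : Lp ℝ 1 ν) : G → ℝ) =ᵐ[ν] fun x => (g⁻¹ • C).indicator (fun _ => (1 : ℝ)) x := by
        have hF' : (F : G → ℝ) =ᵐ[ν] C.indicator fun _ => (1 : ℝ) := indicatorConstLp_coeFn
        have h2 : ((DomMulAct.mk g • F : Lp ℝ 1 ν) : G → ℝ) =ᵐ[ν] fun x => (F : G → ℝ) (g • x) := by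
          simpa only [DomMulAct.mk.symm_apply_apply] using DomMulAct.smul_Lp_ae_eq (DomMulAct.mk g) F
        have h3 : (fun x => (F : G → ℝ) (g • x)) =ᵐ[ν] fun x => (C.indicator fun _ => (1 : ℝ)) (g • x) :=
          (MeasurePreserving.quasiMeasurePreserving (measurePreserving_smul g ν)).ae_eq_comp hF'
        have h4 : (fun x => (C.indicator fun _ => (1 : ℝ)) (g • x)) = fun x => (g⁻¹ • C).indicator (fun _ => (1 : ℝ)) x := by
          funext x
          by_cases hx : g • x ∈ C
          · have hx' : x ∈ g⁻¹ • C := by rwa [mem_smul_set_iff_inv_smul_mem, inv_inv]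
            rw [Set.indicator_of_mem hx, Set.indicator_of_mem hx']
          · have hx' : x ∉ g⁻¹ • C := by rwa [mem_smul_set_iff_inv_smul_mem, inv_inv]
            rw [Set.indicator_of_notMem hx, Set.indicator_of_notMem hx']
        rw [h4] at h3
        exact h2.trans h3
      calc Ψ g = ∫ x in T, (g⁻¹ • C).indicator (fun _ => (1 : ℝ)) x ∂ν :=
            setIntegral_congr_ae hT (h1.mono fun x hx _ => hx)
        _ = ∫ x in T ∩ g⁻¹ • C, (1 : ℝ) ∂ν := setIntegral_indicator (hC.const_smul g⁻¹)
        _ = ν.real (T ∩ g⁻¹ • C) := by rw [setIntegral_const, smul_eq_mul, mul_one]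
        _ = ν.real (g • T ∩ C) := by
            rw [show T ∩ g⁻¹ • C = g⁻¹ • (g • T ∩ C) by rw [smul_set_inter, inv_smul_smul],
              measureReal_def, measureReal_def, measure_smul]
    -- `Ψ` is constant on the dense set `D`
    have hΨD : ∀ g : G, Ψ g = Ψ 1 := by
      have hEq : EqOn Ψ (fun _ => Ψ 1) D := fun d hd => by
        simp only [hΨv, hinv d hd, one_smul]
      intro g
      exact congrFun (hΨc.ext_on hD continuous_const hEq) g
    intro g
    have h := hΨD g
    rw [hΨv, hΨv, one_smul, measureReal_def, measureReal_def] at h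
    exact (ENNReal.toReal_eq_toReal_iff' (measure_ne_top_of_subset inter_subset_right hCfin)
      (measure_ne_top_of_subset inter_subset_right hCfin)).1 h
  -- (2) exhaust `G` by measurable sets of finite measure (`ν` is σ-finite)
  have hgT : MeasurableSet (g • T) := hT.const_smul g
  rw [ae_eq_set]
  constructor
  · -- `ν (g • T \ T) = 0`
    have h : ∀ n : ℕ, ν ((g • T \ T) ∩ spanningSets ν n) = 0 := by
      intro n
      have hC : MeasurableSet (spanningSets ν n \ T) := (measurableSet_spanningSets ν n).diff hT
      have hCfin : ν (spanningSets ν n \ T) ≠ ∞ :=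
        measure_ne_top_of_subset sdiff_subset (measure_spanningSets_lt_top ν n).ne
      have h1 := key _ hC hCfin g
      rw [show T ∩ (spanningSets ν n \ T) = ∅ by
        ext x; simp only [mem_inter_iff, Set.mem_sdiff, mem_empty_iff_false]; tauto, measure_empty] at h1
      rw [show (g • T \ T) ∩ spanningSets ν n = g • T ∩ (spanningSets ν n \ T) by
        ext x; simp only [mem_inter_iff, Set.mem_sdiff]; tauto]
      exact h1
    have hU : g • T \ T = ⋃ n, (g • T \ T) ∩ spanningSets ν n := by
      rw [← inter_iUnion, iUnion_spanningSets, inter_univ]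
    rw [hU]
    exact measure_iUnion_null h
  · -- `ν (T \ g • T) = 0`
    have h : ∀ n : ℕ, ν ((T \ g • T) ∩ spanningSets ν n) = 0 := by
      intro n
      have hC : MeasurableSet (spanningSets ν n ∩ T) := (measurableSet_spanningSets ν n).inter hT
      have hCfin : ν (spanningSets ν n ∩ T) ≠ ∞ :=
        measure_ne_top_of_subset inter_subset_left (measure_spanningSets_lt_top ν n).ne
      have h1 := key _ hC hCfin g
      rw [show T ∩ (spanningSets ν n ∩ T) = spanningSets ν n ∩ T by
        ext x; simp only [mem_inter_iff]; tauto] at h1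
      have h2 := measure_inter_add_sdiff (μ := ν) (spanningSets ν n ∩ T) hgT
      rw [show spanningSets ν n ∩ T ∩ g • T = g • T ∩ (spanningSets ν n ∩ T) by
        ext x; simp only [mem_inter_iff]; tauto, h1] at h2
      have h3 : ν ((spanningSets ν n ∩ T) \ g • T) = 0 :=
        (ENNReal.add_right_inj hCfin).1 (h2.trans (add_zero _).symm)
      rw [show (T \ g • T) ∩ spanningSets ν n = (spanningSets ν n ∩ T) \ g • T by
        ext x; simp only [mem_inter_iff, Set.mem_sdiff]; tauto]
      exact h3
    have hU : T \ g • T = ⋃ n, (T \ g • T) ∩ spanningSets ν n := by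
      rw [← inter_iUnion, iUnion_spanningSets, inter_univ]
    rw [hU]
    exact measure_iUnion_null h

/-- **Moore's ergodicity lemma: a closed normal subgroup `M` with `M · Stab(x₀)` dense acts ergodically on a homogeneous space.**  Let a locally
compact second countable group `G` act continuously and transitively on a Borel space `X` with an invariant s-finite measure `μ`; let `x₀ ∈ X` and
let `M ⊴ G` be a closed normal subgroup such that `M · Stab_G(x₀)` is dense in `G`.  Then a measurable `s ⊆ X` with `m⁻¹ s = s` a.e. for every
`m ∈ M` is `μ`-null or conull.  (Pull `s` back along the orbit map to `S ⊆ G`, exactly right-`Stab(x₀)`-invariant and a.e. left-`M`-invariant;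
strictify over the Haar measure of `M`, `S' = {g | mg ∈ S for a.e. m}`, `S' = S` a.e. by Fubini; `S'` is exactly left- hence, by normality, right-
`M`-invariant and right-`Stab(x₀)`-invariant, so `T = S'⁻¹` is exactly left-invariant under the dense set `M · Stab(x₀)`; by
`smul_set_ae_eq_of_dense` it is a.e. invariant under every left translation, hence Haar-null or conull (Mathlib `ErgodicSMul G G ν`), and the
null-set dictionary transports this back to `s`.)  The density hypothesis is exactly «the `M`-orbit of the base point of `G/H` is dense», and
for `G = G_∞ × G(𝔸_f)`, `M = G(𝔸_f)`, `H = G(K)` it is weak approximation at the archimedean places. [cite: Zimmer1984, §2.2 Cor. 2.2.3 and Lemma 2.2.13; App. B Prop. B.5]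
[cite: BekkaMayer2000, Ch. III §1] -/
theorem ergodicSMul_subgroup_of_dense_mul_stabilizer (μ : Measure X) [SFinite μ] [SMulInvariantMeasure G X μ]
    (M : Subgroup G) [M.Normal] (hM : IsClosed (M : Set G)) (x₀ : X)
    (hd : Dense ((M : Set G) * (MulAction.stabilizer G x₀ : Set G))) :
    ErgodicSMul M X μ := by
  borelize G
  haveI : SMulInvariantMeasure M X μ :=
    ⟨fun m s hs => SMulInvariantMeasure.measure_preimage_smul (μ := μ) (m : G) hs⟩
  refine ⟨fun {s} hs hinv => ?_⟩
  rcases eq_zero_or_neZero μ with rfl | hμ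
  · rw [eventuallyConst_set, ae_zero]
    exact Or.inl eventually_bot
  set ν : Measure G := Measure.haar with hν
  set Θ : G → X := fun g => g • x₀ with hΘ
  have hΘm : Measurable Θ := (continuous_id.smul continuous_const).measurable
  have key : ∀ A : Set X, MeasurableSet A → (μ A = 0 ↔ ν (Θ ⁻¹' A) = 0) := fun A hA =>
    measure_eq_zero_iff_measure_preimage_orbit_eq_zero μ ν x₀ hA
  set S : Set G := Θ ⁻¹' s with hSdef
  have hS : MeasurableSet S := hΘm hs
  -- (a) `S` is a.e. invariant under left translation by `M`
  have hSinv : ∀ m : M, ∀ᵐ g ∂ν, ((m : G) * g ∈ S ↔ g ∈ S) := by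
    intro m
    have h1 : ((m : G) • ·) ⁻¹' S = Θ ⁻¹' ((m • ·) ⁻¹' s) := by
      ext k
      simp only [mem_preimage, hSdef, hΘ, smul_eq_mul, mul_smul, Subgroup.smul_def]
    have hgs : MeasurableSet ((m • ·) ⁻¹' s) :=
      measurableSet_preimage (measurable_const_smul (m : G)) hs
    have h2 := hinv m
    rw [ae_eq_set] at h2
    have e1 : ν (((m : G) • ·) ⁻¹' S \ S) = 0 := by
      rw [h1, hSdef, ← preimage_sdiff]
      exact (key _ (hgs.diff hs)).1 h2.1
    have e2 : ν (S \ ((m : G) • ·) ⁻¹' S) = 0 := by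
      rw [h1, hSdef, ← preimage_sdiff]
      exact (key _ (hs.diff hgs)).1 h2.2
    have h3 : ((m : G) • ·) ⁻¹' S =ᵐ[ν] S := ae_eq_set.2 ⟨e1, e2⟩
    exact eventuallyEq_set.1 h3
  -- (b) `S` is exactly invariant under right translation by the stabilizer of `x₀`
  have hSH : ∀ h ∈ MulAction.stabilizer G x₀, ∀ g : G, g * h ∈ S ↔ g ∈ S := by
    intro h hh g
    simp only [hSdef, mem_preimage, hΘ, mul_smul, MulAction.mem_stabilizer_iff.1 hh]
  -- Haar measure on the closed subgroup `M` (locally compact, second countable)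
  haveI : SecondCountableTopology M := TopologicalSpace.Subtype.secondCountableTopology (M : Set G)
  haveI : LocallyCompactSpace M := hM.locallyCompactSpace
  set νM : Measure M := Measure.haar with hνM
  have hνM0 : νM (univ : Set M) ≠ 0 := isOpen_univ.measure_ne_zero νM ⟨1, trivial⟩
  -- (c) strictification: `S' = {g | m g ∈ S for a.e. m ∈ M}`
  set S' : Set G := {g | ∀ᵐ (m : M) ∂νM, (m : G) * g ∈ S} with hS'def
  have hmul : Measurable fun p : M × G => (p.1 : G) * p.2 :=
    ((continuous_subtype_val.comp continuous_fst).mul continuous_snd).measurable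
  have hE : MeasurableSet {p : M × G | (p.1 : G) * p.2 ∈ S} := hmul hS
  have hS'm : MeasurableSet S' := by
    have h := measurable_measure_prodMk_right (μ := νM) hE.compl
    have hS'eq : S' = (fun g : G => νM ((fun m : M => (m, g)) ⁻¹' {p : M × G | (p.1 : G) * p.2 ∈ S}ᶜ)) ⁻¹' {0} := by
      ext g
      simp only [hS'def, mem_setOf_eq, mem_preimage, mem_singleton_iff]
      rw [ae_iff]
      rfl
    rw [hS'eq]
    exact h (measurableSet_singleton 0)
  -- `S' = S` a.e. (Fubini)
  have hS'S : S' =ᵐ[ν] S := by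
    have h2 : ∀ᵐ (m : M) ∂νM, ∀ᵐ g ∂ν, ((m : G) * g ∈ S ↔ g ∈ S) := ae_of_all _ hSinv
    have hmeas : MeasurableSet {p : M × G | ((p.1 : G) * p.2 ∈ S ↔ p.2 ∈ S)} := by
      have heq : {p : M × G | ((p.1 : G) * p.2 ∈ S ↔ p.2 ∈ S)} =
          ({p : M × G | (p.1 : G) * p.2 ∈ S} ∩ {p | p.2 ∈ S}) ∪ ({p : M × G | (p.1 : G) * p.2 ∈ S}ᶜ ∩ {p | p.2 ∈ S}ᶜ) := by
        ext p
        simp only [mem_setOf_eq, mem_union, mem_inter_iff, mem_compl_iff]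
        tauto
      rw [heq]
      exact (hE.inter (measurable_snd hS)).union (hE.compl.inter (measurable_snd hS).compl)
    have h3 : ∀ᵐ g ∂ν, ∀ᵐ (m : M) ∂νM, ((m : G) * g ∈ S ↔ g ∈ S) := (Measure.ae_ae_comm hmeas).1 h2
    refine eventuallyEq_set.2 ?_
    filter_upwards [h3] with g hg
    constructor
    · intro hg'
      by_contra hgS
      have hfalse : ∀ᵐ (_m : M) ∂νM, False := by
        filter_upwards [hg', hg] with m hm1 hm2
        exact hgS (hm2.1 hm1)
      have h0 := ae_iff.1 hfalse
      simp only [not_false_eq_true, setOf_true] at h0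
      exact hνM0 h0
    · intro hgS
      filter_upwards [hg] with m hm
      exact hm.2 hgS
  -- `S'` is EXACTLY invariant under left translation by `M`
  have hS'M : ∀ (m₀ : M) (g : G), (m₀ : G) * g ∈ S' ↔ g ∈ S' := by
    intro m₀ g
    simp only [hS'def, mem_setOf_eq]
    have h1 : (∀ᵐ (m : M) ∂νM, (m : G) * ((m₀ : G) * g) ∈ S) ↔ ∀ᵐ (m : M) ∂νM, ((m * m₀ : M) : G) * g ∈ S := by
      simp only [Subgroup.coe_mul, mul_assoc]
    rw [h1, ae_iff, ae_iff]
    exact measure_mul_right_null (s := {a : M | ¬ ((a : G) * g ∈ S)}) νM m₀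
  -- `S'` is exactly invariant under right translation by the stabilizer
  have hS'H : ∀ h ∈ MulAction.stabilizer G x₀, ∀ g : G, g * h ∈ S' ↔ g ∈ S' := by
    intro h hh g
    simp only [hS'def, mem_setOf_eq, ← mul_assoc, hSH h hh]
  -- `S'` is exactly invariant under right translation by `M` (normality)
  have hS'Mr : ∀ (m₀ : M) (g : G), g * (m₀ : G) ∈ S' ↔ g ∈ S' := by
    intro m₀ g
    have hc : g * (m₀ : G) * g⁻¹ ∈ M := Subgroup.Normal.conj_mem inferInstance (m₀ : G) m₀.2 g
    have h1 := hS'M ⟨g * (m₀ : G) * g⁻¹, hc⟩ g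
    simpa only [Subgroup.coe_mk, inv_mul_cancel_right] using h1
  -- `T = S'⁻¹` is exactly invariant under left translation by the dense set `M · Stab(x₀)`
  set T : Set G := S'⁻¹ with hTdef
  have hT : MeasurableSet T := hS'm.inv
  have hTinv : ∀ d ∈ (M : Set G) * (MulAction.stabilizer G x₀ : Set G), d • T = T := by
    rintro d ⟨m, hm, h, hh, rfl⟩
    ext t
    rw [mem_smul_set_iff_inv_smul_mem, smul_eq_mul, hTdef, Set.mem_inv, Set.mem_inv, mul_inv_rev, inv_inv,
      ← mul_assoc, hS'H h hh, hS'Mr ⟨m, hm⟩]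
  have hTae : ∀ g : G, g • T =ᵐ[ν] T := fun g => smul_set_ae_eq_of_dense ν hT hd hTinv g
  have hTconst : EventuallyConst T (ae ν) :=
    aeconst_of_forall_smul_ae_eq G hT.nullMeasurableSet hTae
  -- back to `S'`, `S` and `s`
  rw [eventuallyConst_set] at hTconst ⊢
  rcases hTconst with h | h
  · -- `T` conull ⇒ `S'` conull ⇒ `S` conull ⇒ `s` conull
    left
    have hT' : ν Tᶜ = 0 := mem_ae_iff.1 (eventually_mem_set.1 h)
    have hS'c : ν S'ᶜ = 0 := by
      rw [hTdef, ← compl_inv] at hT'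
      exact (measure_inv_null ν).1 hT'
    have hSc : ν Sᶜ = 0 := by rwa [← measure_congr hS'S.compl]
    have hsc : μ sᶜ = 0 := (key _ hs.compl).2 (by rwa [preimage_compl])
    exact eventually_mem_set.2 (mem_ae_iff.2 hsc)
  · -- `T` null ⇒ `S'` null ⇒ `S` null ⇒ `s` null
    right
    have hT' : ν T = 0 := measure_eq_zero_iff_ae_notMem.2 h
    have hS'0 : ν S' = 0 := (measure_inv_null ν).1 hT'
    have hS0 : ν S = 0 := by rwa [← measure_congr hS'S]
    exact measure_eq_zero_iff_ae_notMem.1 ((key _ hs).2 hS0)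

end Subgroup

/-! ## §2 Subgroups of `G(𝔸_K)` acting ergodically on the automorphic quotient; `M`-fixed `L²` functions are constant -/

namespace AdelicGroupData

universe u

variable {K : Type} [Field K] [NumberField K] (𝒢 : AdelicGroupData.{u} K)
  [LocallyCompactSpace 𝒢.Adelic] [SecondCountableTopology 𝒢.Adelic]
  (μ : Measure 𝒢.automorphicQuotient) [𝒢.IsAutomorphicMeasure μ]
  (M : Subgroup 𝒢.Adelic) [M.Normal]

/-- **A closed normal subgroup `M ≤ G(𝔸_K)` with `M · (A_G · G(K))` dense in `G(𝔸_K)` acts ergodically on the automorphic quotient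
`G(𝔸_K) ⧸ (A_G · G(K))`** (any automorphic measure; finite and invariant suffices): the stabilizer of the base point is `A_G · G(K)` (Mathlib
`MulAction.stabilizer_quotient`), so `ergodicSMul_subgroup_of_dense_mul_stabilizer` applies.  For `G(𝔸_K) = G_∞ · G(𝔸_{K,f})` and `M = G(𝔸_{K,f})`
the hypothesis is weak approximation at the archimedean places («`G(K)` is dense in `G_∞`»). [cite: Zimmer1984, §2.2 Cor. 2.2.3] -/
theorem ergodicSMul_subgroup_automorphicQuotient (hM : IsClosed (M : Set 𝒢.Adelic))
    (hd : Dense ((M : Set 𝒢.Adelic) * (𝒢.quotientSubgroup : Set 𝒢.Adelic))) :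
    ErgodicSMul M 𝒢.automorphicQuotient μ := by
  haveI : MulAction.IsPretransitive 𝒢.Adelic 𝒢.automorphicQuotient :=
    inferInstanceAs (MulAction.IsPretransitive 𝒢.Adelic (𝒢.Adelic ⧸ 𝒢.quotientSubgroup))
  have hstab : MulAction.stabilizer 𝒢.Adelic (𝒢.toAutomorphicQuotient 1) = 𝒢.quotientSubgroup :=
    MulAction.stabilizer_quotient 𝒢.quotientSubgroup
  refine ergodicSMul_subgroup_of_dense_mul_stabilizer μ M hM (𝒢.toAutomorphicQuotient 1) ?_
  rw [hstab]
  exact hd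

/-- **An `L²` function on the automorphic quotient fixed by `R(m)` for every `m` in a closed normal subgroup `M` with `M · (A_G · G(K))` dense is
a.e. constant** (ergodicity of `M`, `ergodicSMul_subgroup_automorphicQuotient`, applied to the a.e. identities `f (m⁻¹ • x) = f x`; the `M`-version
of ★ `ae_eq_const_of_rightRegular_apply_eq`). [cite: Zimmer1984, §2.2 Cor. 2.2.3] -/
theorem ae_eq_const_of_forall_mem_rightRegular_apply_eq (hM : IsClosed (M : Set 𝒢.Adelic))
    (hd : Dense ((M : Set 𝒢.Adelic) * (𝒢.quotientSubgroup : Set 𝒢.Adelic))) {f : 𝒢.L2 μ}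
    (hf : ∀ m ∈ M, 𝒢.rightRegular μ m f = f) :
    ∃ c : ℂ, (f : 𝒢.automorphicQuotient → ℂ) =ᵐ[μ] Function.const _ c := by
  haveI := 𝒢.ergodicSMul_subgroup_automorphicQuotient μ M hM hd
  refine ae_eq_const_of_forall_smul_ae_eq (G := M) (Lp.aestronglyMeasurable f) fun m => ?_
  have h := 𝒢.rightRegular_apply_coeFn μ (m : 𝒢.Adelic)⁻¹ f
  rw [hf _ (M.inv_mem m.2), inv_inv] at h
  exact h.symm

end AdelicGroupData

end Literature.NumberTheory.Automorphic
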